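import Summits.BirchSwinnertonDyer.Rank1Residual.Additive.SplitMultiplicativeWitnessKodairaNeron
import Literature.NumberTheory.EllipticCurves.TateNormalFormUnramifiedComponentsProofs
import Literature.NumberTheory.EllipticCurves.TateNormalFormUnramifiedClassesProofs
import Literature.NumberTheory.EllipticCurves.MultiplicativeUnramifiedTorsionProofs
import Literature.NumberTheory.EllipticCurves.SplitMultiplicativeNormalForm
import Literature.NumberTheory.EllipticCurves.LocalKummerMap
import HarnessLib

/-!
# The `E[p]` instance of the N2 parity law, PART IX: the LOCAL TERM at a `T_E`-place —
# `#𝓛_v = p · #(𝓛_v ⊓ H¹_ur(K_v, E[p]))` at a split multiplicative `v ∤ p` with `p ∣ c_v`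
# (cell `b2b-bsdres`, unit `b2b-bsdres-x10` = N2 class lead, GEN 31; theorems only, no definition,
# no named fact, nothing booked — glue G8 of `class-closure/N2/P-INSTANCE-ASK-x10g31.md`)

HONEST FRAMING (run/shared/lean/b2b/bsd-rank1-residual/, verbatim in every file): the goal of the
cell is to DELETE the COMBINATION-SHAPED residual classes of the Birch–Swinnerton-Dyer formula for
ALL analytic-rank `≤ 1` elliptic curves over `ℚ` — "full BSD formula for every rank `≤ 1` curve in
class `C`" assembled STRICTLY from published theorems — so that the rank-`≤ 1` remainder becomes
exactly the CONSTRUCTION-SHAPED classes, which are TYPED (missing-input `Prop`s), NOT attempted.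
This is not "finishing BSD". Class X10b (= N2) keeps its label CONSTRUCTION-SHAPED (NEEDS `X_A3`,
referee R82.3 / RESIDUAL-MAP §I N2); this file is a TOOL; no mark / label / tier / count moves.

## What

Mazur–Rubin 2007, proof of Thm. 1.4 / Prop. 1.3: at a place `v ∤ p` of split multiplicative
reduction with `p ∣ c_v` the Kummer condition `𝓛_v = im(E(K_v)/p → H¹(K_v, E[p]))` and the
unramified condition `H¹_ur` meet in a subgroup of index EXACTLY `p` in `𝓛_v`:
`𝓛_v/(𝓛_v ∩ H¹_ur) ≅ E(K_v)/(E₀(K_v) + pE(K_v)) ≅ Φ_v(k_v)/pΦ_v(k_v) ≅ ℤ/p`, `Φ_v(k_v) ≅ ℤ/c_v`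
cyclic (Kodaira–Néron, Silverman *ATAEC* Cor. IV.9.2(d)); `κ(P)` is unramified iff `P` has an
inertia-fixed `p`-th root in `E(K̄_v)` (Silverman VIII.2.1), points of `E₀` have such roots
(`E₀(K_v^nr)` is `p`-divisible: `E₀/E₁ ≅ k̄^×`, `E₁` uniquely `p`-divisible, Silverman VII.2.1–2),
and every point of `E(K_v^nr)` is congruent mod `E₀` to a multiple of a RATIONAL generator
(Greenberg LNM 1716 §3 p. 74 "`|ker r_v| = c_v^{(p)}`"). Every ingredient is a theorem of the tree
(team n1011: `KummerVersusUnramifiedLocal`, `SplitMultiplicativeWitnessKodairaNeron`; the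
Matsuno-2009 chain: `TateNormalFormUnramifiedComponentsProofs`; `MultiplicativeUnramifiedTorsionProofs`):

* §0 `index_eq_of_generator` — group bookkeeping: `E₀ ⊔ pE` has index `p` in an abelian group `E`
  when `E/E₀` is generated by one class of exact order-divisibility `n`, `p ∣ n`.
* §1 `exists_nsmul_eq_fixed_of_reducesToNonsingular_of_tateNormalForm` — on the Tate normal form
  `y² + xy = x³ + a` over `𝓞_v`, an inertia-fixed point of `E₀(K̄_v)` is `p • S` with `S ∈ E₀`
  inertia-fixed (`p` a unit at `v`).
* §2 `natCard_kummerLocalConditionAt_eq_mul` — **`#𝓛_v = p · #(𝓛_v ⊓ H¹_ur)`** at a split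
  multiplicative `v ∤ p` with `p ∣ c_v(E)`; THE binder `hterm` of
  `X10/ResidualSelmerParityInstance.even_add_add_card` at the `T_E`-places.

## References

* [MazurRubin2007] Def. 1.2, Prop. 1.3, proof of Thm. 1.4. [GreenbergLNM1716] §3 p. 74, Cor. 5.6.
* [SilvermanAEC2009] VII.2.1, VII.2.2, VII.3.1, VII.6.1, VIII.2.1. [SilvermanATAEC1994] Cor. IV.9.2(d).
* HOME/class-closure/N2/P-INSTANCE-ASK-x10g31.md (G8); HOME/X10-AUDIT.md §§35–37.
-/

set_option autoImplicit false

noncomputable section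

open scoped Classical NNReal

open Function NumberField IsDedekindDomain Field WeierstrassCurve IsLocalRing
  Literature.NumberTheory.EllipticCurves Literature.NumberTheory.GaloisRepresentations
  IsDedekindDomain.HeightOneSpectrum
open Summit.BirchSwinnertonDyer.Rank1Residual.Additive

namespace Summit.BirchSwinnertonDyer.Rank1Residual.X10.ResidualSelmerLocalTerm

/-! ### §0. Group bookkeeping: the index of `E₀ ⊔ pE` from a generator of `E/E₀` -/

/-- If `E₀ ≤ E` (abelian), every `P` is congruent mod `E₀` to a multiple of `g`, and
`i • g ∈ E₀ ↔ n ∣ i`, then for a prime `p ∣ n` the subgroup `E₀ ⊔ pE` has index `p`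
(`E/(E₀ + pE) ≅ (ℤ/n)/p ≅ ℤ/p`). [folklore] -/
theorem index_eq_of_generator {E : Type*} [AddCommGroup E] (E₀ : AddSubgroup E) (g : E) {n p : ℕ}
    [hp : Fact p.Prime] (hpn : p ∣ n) (hgen : ∀ P : E, ∃ i : ℕ, P - i • g ∈ E₀)
    (hord : ∀ i : ℕ, i • g ∈ E₀ ↔ n ∣ i) :
    (E₀ ⊔ (zsmulAddGroupHom (p : ℤ) : E →+ E).range).index = p := by
  set B := E₀ ⊔ (zsmulAddGroupHom (p : ℤ) : E →+ E).range with hB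
  -- integer version of `hord`
  have hordz : ∀ z : ℤ, z • g ∈ E₀ → (n : ℤ) ∣ z := by
    intro z hz
    rcases Int.natAbs_eq z with h | h
    · rw [h, natCast_zsmul] at hz
      rw [h]; exact Int.natCast_dvd_natCast.mpr ((hord _).mp hz)
    · rw [h, neg_zsmul, natCast_zsmul] at hz
      rw [h]; exact (Int.dvd_neg).mpr (Int.natCast_dvd_natCast.mpr ((hord _).mp (neg_mem_iff.mp hz)))
  -- the class of `g` in `E ⧸ B` has order `p` and generates
  set x : E ⧸ B := QuotientAddGroup.mk g with hx
  have hpx : p • x = 0 := by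
    rw [hx, ← QuotientAddGroup.mk_nsmul, QuotientAddGroup.eq_zero_iff, hB]
    exact AddSubgroup.mem_sup_right ⟨g, by simp [natCast_zsmul]⟩
  have hx0 : x ≠ 0 := by
    intro h0
    rw [hx, QuotientAddGroup.eq_zero_iff, hB] at h0
    obtain ⟨e₀, he₀, k, ⟨Q, rfl⟩, hsum⟩ := AddSubgroup.mem_sup.mp h0
    obtain ⟨j, hj⟩ := hgen Q
    -- `g = e₀ + p • Q`, `Q = j • g + e₁` ⟹ `(1 - p j) • g ∈ E₀`
    have hmem : ((1 : ℤ) - (p : ℤ) * j) • g ∈ E₀ := by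
      have hpQ : (p : ℤ) • Q = g - e₀ := by
        rw [← hsum, zsmulAddGroupHom_apply]; abel
      have h1 : ((1 : ℤ) - (p : ℤ) * j) • g = e₀ + (p : ℤ) • (Q - j • g) := by
        have hj' : (j • g : E) = (j : ℤ) • g := (natCast_zsmul g j).symm
        rw [hj', zsmul_sub, hpQ, sub_zsmul, one_zsmul, mul_zsmul]; abel
      rw [h1]
      exact E₀.add_mem he₀ (E₀.zsmul_mem hj _)
    have hdvd := hordz _ hmem
    have hp1 : (p : ℤ) ∣ 1 := by
      have h1 := (Int.natCast_dvd_natCast.mpr hpn).trans hdvd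
      have h2 : (p : ℤ) ∣ (p : ℤ) * j := dvd_mul_right _ _
      have h3 := dvd_add h1 h2
      rwa [sub_add_cancel] at h3
    exact hp.out.ne_one (by exact_mod_cast Int.eq_one_of_dvd_one (Int.natCast_nonneg p) hp1)
  have horder : addOrderOf x = p := addOrderOf_eq_prime hpx hx0
  have htop : AddSubgroup.zmultiples x = ⊤ := by
    rw [eq_top_iff]
    rintro y -
    obtain ⟨P, rfl⟩ := QuotientAddGroup.mk_surjective y
    obtain ⟨i, hi⟩ := hgen P
    refine ⟨(i : ℤ), ?_⟩
    change (i : ℤ) • x = QuotientAddGroup.mk P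
    rw [hx, ← QuotientAddGroup.mk_zsmul, eq_comm, QuotientAddGroup.eq, hB]
    refine AddSubgroup.mem_sup_left ?_
    have : -P + (i : ℤ) • g = -(P - i • g) := by rw [natCast_zsmul]; abel
    rw [this]
    exact neg_mem hi
  calc B.index = Nat.card (E ⧸ B) := rfl
    _ = Nat.card (AddSubgroup.zmultiples x) := by rw [htop, AddSubgroup.card_top]
    _ = p := by rw [Nat.card_zmultiples, horder]

/-! ### §1. Inertia-fixed `p`-th roots of the points of `E₀` on the Tate normal form -/

variable {K : Type} [Field K] [NumberField K] {v : HeightOneSpectrum (𝓞 K)}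
  {w : Valuation (AlgebraicClosure (v.adicCompletion K)) ℝ≥0}
  (hw : ∀ x, (w x : ℝ) = spectralNorm (v.adicCompletion K) (AlgebraicClosure (v.adicCompletion K)) x)

include hw in
/-- **Points of `E₀` have inertia-fixed `p`-th roots in `E₀`.** For the Tate normal form
`J : y² + xy = x³ + a` (`a ∈ 𝔪_v`) over `𝓞_v`, a prime `p` with `v ∤ p`, and a point `Y` of
`J(K̄_v)` fixed by the inertia group `I_𝔐` and reducing to a nonsingular point: `Y = p • S` with
`S ∈ E₀` fixed by `I_𝔐` (node map `E₀ ↠ k̄^×` with uniquely `p`-divisible kernel `E₁`;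
`σS - S ∈ E₁[p] = 0` for `σ ∈ I_𝔐`). [cite: SilvermanAEC2009, VII.2 Prop. 2.1, VII.2.2, VII.3 Prop. 3.1(a)] -/
theorem exists_nsmul_eq_fixed_of_reducesToNonsingular_of_tateNormalForm
    (J : WeierstrassCurve (v.adicCompletionIntegers K))
    (h1 : J.a₁ = 1) (h2 : J.a₂ = 0) (h3 : J.a₃ = 0) (h4 : J.a₄ = 0)
    (h6 : J.a₆ ∈ maximalIdeal (v.adicCompletionIntegers K))
    [((J.baseChange (v.adicCompletion K)).baseChange (AlgebraicClosure (v.adicCompletion K))).IsElliptic]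
    {p : ℕ} (hp : p.Prime) (hpv : (p : 𝓞 K) ∉ v.asIdeal)
    {𝔐 : Ideal v.localAbsIntegers} (h𝔐 : 𝔐 ∈ v.localPrimesAbove)
    (Y : ((J.baseChange (v.adicCompletion K)).baseChange (AlgebraicClosure (v.adicCompletion K))).toAffine.Point)
    (hYfix : ∀ τ ∈ 𝔐.inertia (absoluteGaloisGroup (v.adicCompletion K)),
      Affine.Point.map ((absoluteGaloisGroup.toAlgEquiv _ τ :
          AlgebraicClosure (v.adicCompletion K) ≃ₐ[v.adicCompletion K]
            AlgebraicClosure (v.adicCompletion K)) :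
          AlgebraicClosure (v.adicCompletion K) →ₐ[v.adicCompletion K]
            AlgebraicClosure (v.adicCompletion K)) Y = Y)
    (hY : ReducesToNonsingular w (residue w.integer) Y) :
    ∃ S : ((J.baseChange (v.adicCompletion K)).baseChange (AlgebraicClosure (v.adicCompletion K))).toAffine.Point,
      ReducesToNonsingular w (residue w.integer) S ∧ p • S = Y ∧
      ∀ τ ∈ 𝔐.inertia (absoluteGaloisGroup (v.adicCompletion K)),
        Affine.Point.map ((absoluteGaloisGroup.toAlgEquiv _ τ :
            AlgebraicClosure (v.adicCompletion K) ≃ₐ[v.adicCompletion K]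
              AlgebraicClosure (v.adicCompletion K)) :
            AlgebraicClosure (v.adicCompletion K) →ₐ[v.adicCompletion K]
              AlgebraicClosure (v.adicCompletion K)) S = S := by
  have hv0 : w.Integers w.integer := Valuation.integer.integers w
  obtain ⟨W₀, hW₀, h01, h02, h03, h04, h06⟩ := exists_integerModel_of_tateNormalForm hw J h1 h2 h3 h4 h6
  -- the reduction of `W₀` is a node: `c₄ = 1`, `Δ = -a(1 + 432 a) ∈ 𝔪_w`
  have hc₄ : W₀.c₄ = 1 := by
    simp only [WeierstrassCurve.c₄, WeierstrassCurve.b₂, WeierstrassCurve.b₄, h01, h02, h03, h04]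
    ring
  have hΔ : W₀.Δ ∈ maximalIdeal w.integer := by
    rw [W₀.Δ_eq_of_tateNormalForm h01 h02 h03 h04]
    exact neg_mem (Ideal.mul_mem_right _ _ h06)
  have hΔ₀ : residue w.integer W₀.Δ = 0 := (residue_eq_zero_iff _).mpr hΔ
  have hc₄₀ : residue w.integer W₀.c₄ ≠ 0 := by rw [hc₄, map_one]; exact one_ne_zero
  haveI := henselianRing_integer w
  haveI := isAlgClosed_residueField_integer w
  obtain ⟨r, hrsurj, hrker⟩ := W₀.exists_addMonoidHom_units_of_node_of_isAlgClosed hv0 hΔ₀ hc₄₀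
  -- `|p|_v = 1`
  have hpunit : IsUnit ((p : ℕ) : v.adicCompletionIntegers K) := by
    have h := isUnit_algebraMap_adicCompletionIntegers K v hpv
    rwa [map_natCast] at h
  have hwp : w ((p : ℕ) : AlgebraicClosure (v.adicCompletion K)) = 1 :=
    spectralValuation_natCast_eq_one_of_isUnit hw hpunit
  -- `E₀` membership read on `W₀`
  have hE₀ : ∀ P, ReducesToNonsingular w (residue w.integer) P ↔
      W₀.HasNonsingularReduction (Affine.Point.congrEquiv hW₀.symm P) := fun P => by
    rw [← reducesToNonsingular_iff_hasNonsingularReduction W₀, reducesToNonsingular_congrEquiv_iff _ hW₀.symm]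
  obtain ⟨S, hSE₀, hpS, hSfix⟩ := W₀.exists_smul_eq_of_hasNonsingularReduction_of_node hW₀.symm r hrsurj
    hrker hp hwp Y ((hE₀ Y).mp hY)
  refine ⟨S, (hE₀ S).mpr hSE₀, hpS, fun τ hτ => ?_⟩
  obtain ⟨hσ₁, hσ₂⟩ := isometry_of_mem_inertia hw h𝔐 hτ
  exact hSfix _ hσ₁ hσ₂ (hYfix τ hτ)

/-! ### §2. The local term `#𝓛_v = p · #(𝓛_v ⊓ H¹_ur)` -/

/-- **The local term at a `T_E`-place (Mazur–Rubin 2007, proof of Thm. 1.4).** For an elliptic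
curve `E = W` over a number field `K`, a prime `p` and a finite place `v ∤ p` of SPLIT
multiplicative reduction with `p ∣ c_v(E)`: `#𝓛_v = p · #(𝓛_v ⊓ H¹_ur(K_v, E[p]))`, i.e. the
Kummer condition meets the unramified condition in index exactly `p`. Proof: with
`A = κ⁻¹(H¹_ur) ≤ E(K_v)` (`κ` the local Kummer map, `ker κ = pE(K_v)`, `im κ = 𝓛_v`), `A`
contains `E₀(K_v) + pE(K_v)` (§1 and Silverman VIII.2.1, n1011's
`localKummerMap_mem_unramifiedSubgroup_iff`), is proper (n1011's Kodaira–Néron witness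
`exists_point_forall_absInertia_not_fixed_of_hasSplitMultiplicativeReductionAt_of_dvd`), and
`[E(K_v) : E₀(K_v) + pE(K_v)] = p` (§0 with the rational generator of `E(K_v^nr)/E₀ ≅ ℤ/c_v` of
the Matsuno chain, `exists_rational_generator_of_tateNormalForm`); so `[E(K_v) : A] = p` and
`#𝓛_v = [E(K_v) : pE] = [E(K_v) : A] · [A : pE] = p · #κ(A) = p · #(𝓛_v ⊓ H¹_ur)`.
[cite: MazurRubin2007, Prop. 1.3 and proof of Thm. 1.4] [cite: GreenbergLNM1716, §3 p. 74 and Cor. 5.6 (proof)]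
[cite: SilvermanATAEC1994, Cor. IV.9.2(d) (PDF p. 340)] -/
theorem natCard_kummerLocalConditionAt_eq_mul (W : WeierstrassCurve K) [W.IsElliptic]
    (v : HeightOneSpectrum (𝓞 K)) {p : ℕ} [hp : Fact p.Prime] (hpv : (p : 𝓞 K) ∉ v.asIdeal)
    (hsplit : W.HasSplitMultiplicativeReductionAt v)
    (hc : p ∣ (W.baseChange (v.adicCompletion K)).localTamagawaNumber (v.adicCompletionIntegers K)) :
    Nat.card (W.kummerLocalConditionAt (p : ℤ) (v.adicCompletion K)) =
      p * Nat.card ↥(W.kummerLocalConditionAt (p : ℤ) (v.adicCompletion K) ⊓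
        DiscreteGaloisModule.unramifiedSubgroup
          ((W.torsionGaloisModule (p : ℤ)).restrictField (v.adicCompletion K)) 1) := by
  have hpp : p.Prime := hp.out
  have hp0 : (p : ℤ) ≠ 0 := by exact_mod_cast hpp.ne_zero
  haveI : CharZero (v.adicCompletion K) :=
    charZero_of_injective_algebraMap (algebraMap K (v.adicCompletion K)).injective
  obtain ⟨w, hw⟩ := v.exists_spectralValuation
  obtain ⟨𝔐, h𝔐⟩ := v.localPrimesAbove_nonempty
  have hv0 : w.Integers w.integer := Valuation.integer.integers w
  set U := DiscreteGaloisModule.unramifiedSubgroup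
    ((W.torsionGaloisModule (p : ℤ)).restrictField (v.adicCompletion K)) 1 with hU
  set A : AddSubgroup (W.baseChange (v.adicCompletion K)).toAffine.Point :=
    U.comap (W.localKummerMap (v.adicCompletion K) hp0) with hA
  have hmemA : ∀ P, P ∈ A ↔ ∃ Q : localPoints W (v.adicCompletion K),
      (p : ℤ) • Q = W.baseChangeGeomPointsEquiv (v.adicCompletion K)
        (toGeomPoints (W.baseChange (v.adicCompletion K)) P) ∧
        ∀ τ ∈ absInertia (v.adicCompletion K), τ • Q = Q := fun P => by
    rw [hA, AddSubgroup.mem_comap, hU, W.localKummerMap_mem_unramifiedSubgroup_iff hp0]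
  /- (1) the Tate normal form `J : y² + xy = x³ + α ϖⁿ` of the minimal model, `n = ord_v Δ_min`,
  `p ∣ n`, and `J_{K_v} = C' • E_{K_v}` -/
  obtain ⟨ϖ, hϖ⟩ := IsDiscreteValuationRing.exists_irreducible (v.adicCompletionIntegers K)
  obtain ⟨D, α, hn1, -, hDX⟩ := W.exists_variableChange_localMinimalModel_eq_tateNormalForm v hsplit hϖ
  have hpn : p ∣ W.ordMinimalDiscriminant v :=
    dvd_ordMinimalDiscriminant_of_dvd_localTamagawaNumber W p v hsplit hc
  set n := W.ordMinimalDiscriminant v with hn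
  set J : WeierstrassCurve (v.adicCompletionIntegers K) :=
    ⟨1, 0, 0, 0, (α : v.adicCompletionIntegers K) * ϖ ^ n⟩ with hJ
  have hJK : J.baseChange (v.adicCompletion K) =
      ⟨1, 0, 0, 0, algebraMap (v.adicCompletionIntegers K) (v.adicCompletion K)
        ((α : v.adicCompletionIntegers K) * ϖ ^ n)⟩ := by
    simp only [hJ, WeierstrassCurve.baseChange, WeierstrassCurve.map, map_one, map_zero]
  have h6 : J.a₆ ∈ maximalIdeal (v.adicCompletionIntegers K) :=
    Ideal.mul_mem_left _ _ (Ideal.pow_mem_of_mem _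
      ((IsLocalRing.mem_maximalIdeal _).mpr hϖ.not_isUnit) n hn1)
  obtain ⟨C, hC⟩ := W.exists_variableChange_smul_eq_localMinimalModel v
  have hC' : (D.baseChange (v.adicCompletion K) * C) • W.baseChange (v.adicCompletion K) =
      J.baseChange (v.adicCompletion K) := by
    rw [mul_smul, hC, hDX, hJK]
  haveI hJell : (J.baseChange (v.adicCompletion K)).IsElliptic := by rw [← hC']; infer_instance
  obtain ⟨Φ, hΦ⟩ := W.exists_addEquiv_localPoints_of_smul_eq v hC'
  /- (2) `g : E(K_v) → J(K̄_v)`, `P ↦ Φ(P)`; its values are `Γ_{K_v}`-fixed -/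
  set g : (W.baseChange (v.adicCompletion K)).toAffine.Point →+
      ((J.baseChange (v.adicCompletion K)).baseChange (AlgebraicClosure (v.adicCompletion K))).toAffine.Point :=
    Φ.toAddMonoidHom.comp ((W.baseChangeGeomPointsEquiv (v.adicCompletion K)).toAddMonoidHom.comp
      (toGeomPoints (W.baseChange (v.adicCompletion K)))) with hg
  have hgapply : ∀ P, g P = Φ (W.baseChangeGeomPointsEquiv (v.adicCompletion K)
      (toGeomPoints (W.baseChange (v.adicCompletion K)) P)) := fun P => rfl
  have hgfix : ∀ P (σ : absoluteGaloisGroup (v.adicCompletion K)),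
      Affine.Point.map ((absoluteGaloisGroup.toAlgEquiv _ σ :
          AlgebraicClosure (v.adicCompletion K) ≃ₐ[v.adicCompletion K]
            AlgebraicClosure (v.adicCompletion K)) :
          AlgebraicClosure (v.adicCompletion K) →ₐ[v.adicCompletion K]
            AlgebraicClosure (v.adicCompletion K)) (g P) = g P := fun P σ => by
    rw [hgapply, ← hΦ, ← W.baseChangeGeomPointsEquiv_smul, smul_toGeomPoints]
  /- (3) `E₀ ⊆ J(K̄_v)` (the points reducing to a nonsingular point) and `E₀' = g⁻¹(E₀) ≤ A` -/
  obtain ⟨W₀, hW₀, -⟩ := exists_integerModel_of_tateNormalForm hw J rfl rfl rfl rfl h6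
  set E₀V := (W₀.nonsingularReductionSubgroup hv0).comap
    (Affine.Point.congrEquiv hW₀.symm).toAddMonoidHom with hE₀V
  have hE₀Vmem : ∀ Q, Q ∈ E₀V ↔ ReducesToNonsingular w (residue w.integer) Q := fun Q => by
    rw [hE₀V, AddSubgroup.mem_comap, AddEquiv.coe_toAddMonoidHom,
      WeierstrassCurve.mem_nonsingularReductionSubgroup_iff,
      ← reducesToNonsingular_iff_hasNonsingularReduction W₀, reducesToNonsingular_congrEquiv_iff _ hW₀.symm]
  set E₀' : AddSubgroup (W.baseChange (v.adicCompletion K)).toAffine.Point := E₀V.comap g with hE₀'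
  have hE₀'A : E₀' ≤ A := fun P hP => by
    rw [hE₀', AddSubgroup.mem_comap, hE₀Vmem] at hP
    obtain ⟨S, -, hpS, hSfix⟩ :=
      exists_nsmul_eq_fixed_of_reducesToNonsingular_of_tateNormalForm hw J rfl rfl rfl rfl h6 hpp hpv
        h𝔐 (g P) (fun τ _ => hgfix P τ) hP
    refine (hmemA P).mpr ⟨Φ.symm S, Φ.injective ?_, fun τ hτ => Φ.injective ?_⟩
    · rw [map_zsmul, AddEquiv.apply_symm_apply, natCast_zsmul, hpS]
      exact hgapply P
    · rw [hΦ, AddEquiv.apply_symm_apply]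
      exact hSfix τ (by rw [inertia_eq_absInertia hw h𝔐]; exact hτ)
  /- (4) `pE(K_v) = ker κ ≤ A` and `A ≠ E(K_v)` (the Kodaira–Néron witness) -/
  have hK : (zsmulAddGroupHom (p : ℤ) : (W.baseChange (v.adicCompletion K)).toAffine.Point →+ _).range ≤
      A := by
    rw [← W.ker_localKummerMap (v.adicCompletion K) hp0]
    intro P hP
    rw [hA, AddSubgroup.mem_comap, (AddMonoidHom.mem_ker).mp hP]
    exact zero_mem _
  have hAtop : A ≠ ⊤ := by
    obtain ⟨P, hP⟩ :=
      exists_point_forall_absInertia_not_fixed_of_hasSplitMultiplicativeReductionAt_of_dvd W v hsplit hpn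
    intro htop
    obtain ⟨Q, hQ, hfix⟩ := (hmemA P).mp (htop ▸ AddSubgroup.mem_top P)
    obtain ⟨τ, hτ, hne⟩ := hP Q hQ
    exact hne (hfix τ hτ)
  /- (5) `[E(K_v) : E₀' + pE(K_v)] = p` from the rational generator of `E(K_v^nr)/E₀ ≅ ℤ/n` -/
  obtain ⟨gV, hgVfix, hgVord, hgVgen⟩ :=
    exists_rational_generator_of_tateNormalForm hw h𝔐 J hϖ rfl rfl rfl rfl α.isUnit hn1 rfl
  obtain ⟨Pstar, hPstar⟩ : ∃ P, g P = gV := by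
    have h1 : ∀ σ : absoluteGaloisGroup (v.adicCompletion K), σ • Φ.symm gV = Φ.symm gV :=
      fun σ => Φ.injective (by rw [hΦ, AddEquiv.apply_symm_apply, hgVfix])
    have h2 : ∀ σ : absoluteGaloisGroup (v.adicCompletion K),
        σ • (W.baseChangeGeomPointsEquiv (v.adicCompletion K)).symm (Φ.symm gV) =
          (W.baseChangeGeomPointsEquiv (v.adicCompletion K)).symm (Φ.symm gV) := fun σ =>
      (W.baseChangeGeomPointsEquiv (v.adicCompletion K)).injective
        (by rw [W.baseChangeGeomPointsEquiv_smul, AddEquiv.apply_symm_apply, h1])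
    obtain ⟨P, hP⟩ := exists_toGeomPoints_eq_of_forall_smul_eq
      (W := W.baseChange (v.adicCompletion K)) h2
    exact ⟨P, by rw [hgapply, hP, AddEquiv.apply_symm_apply, AddEquiv.apply_symm_apply]⟩
  have hgen : ∀ P, ∃ i : ℕ, P - i • Pstar ∈ E₀' := fun P => by
    obtain ⟨i, -, hi⟩ := hgVgen (g P) (fun τ _ => hgfix P τ)
    refine ⟨i, ?_⟩
    rw [hE₀', AddSubgroup.mem_comap, map_sub, map_nsmul, hPstar, hE₀Vmem]
    exact hi
  have hord : ∀ i : ℕ, i • Pstar ∈ E₀' ↔ n ∣ i := fun i => by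
    rw [hE₀', AddSubgroup.mem_comap, map_nsmul, hPstar, hE₀Vmem]
    exact hgVord i
  have hBidx := index_eq_of_generator E₀' Pstar hpn hgen hord
  /- (6) `[E(K_v) : A] = p` -/
  have hAidx : A.index = p := by
    have hdvd : A.index ∣ p := hBidx ▸ AddSubgroup.index_dvd_of_le (sup_le hE₀'A hK)
    rcases (Nat.dvd_prime hpp).mp hdvd with h1 | h1
    · exact absurd (AddSubgroup.index_eq_one.mp h1) hAtop
    · exact h1
  /- (7) the count `#𝓛_v = [E : pE] = [E : A] · [A : pE] = p · #κ(A) = p · #(𝓛_v ⊓ H¹_ur)` -/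
  have hker : (W.localKummerMap (v.adicCompletion K) hp0).ker ≤ A := by
    rw [W.ker_localKummerMap (v.adicCompletion K) hp0]; exact hK
  have h1 := (AddSubgroup.relIndex_mul_index hker).symm
  rw [AddSubgroup.index_ker, AddSubgroup.relIndex_ker, W.range_localKummerMap _ hp0, hAidx, hA,
    AddSubgroup.map_comap_eq, W.range_localKummerMap _ hp0] at h1
  rw [h1, mul_comm]

end Summit.BirchSwinnertonDyer.Rank1Residual.X10.ResidualSelmerLocalTerm

end
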